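import Summits.QuantumFields.BalabanUV.T4Continuum.Support.DirichletCornerRegularity

/-!
# T⁴ programme, spine node NE2 (U1a), sub-row Δ1 «NE2⁰-Dirichlet» — THE CUTOFF `H²` INEQUALITY ON AN ARBITRARY REGION: second
# differences of a zero-extended function UP TO THE FACES, away from the re-entrant edges, with an explicit cutoff cost

NE2 formalisation swarm `b2b-balaban-t4-ne2-formalise-*`, LEAF PROVER 09 (gen 10), supplier item «Δ1-SCALAR-CORNER-H2» file 2 (journal
`HOME/CLAIMS.log` 2026-08-21 l.23790 / l.24182; owner R42 GO).  File 1 `Support/DirichletCornerRegularity` proves, for `w` supported in ANY finite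
`Ω ⊂ Tor N` and VANISHING ON THE CORNER LAYER (the neighbours of the re-entrant exterior sites), road P2's corner-free inequality
`Hdiag c Ω w + Hmixed c w ≤ Σ_{x∈Ω}|(Δw)(x)|²` (`hdiag_le_of_cornerVanish`).  THIS FILE applies it to `w = φ·z` for a supported `z` and a REAL
CUTOFF `φ` killing the corner layer, and pays the commutator `[P_μ, φ]` explicitly:

 * §1 the pointwise Leibniz rule **`phi_mul_Pdir_eq`** `φ·(P_μ z) = P_μ(φz) + c̄c·[δ⁺φ·δ⁺z + δ⁻φ·δ⁻z] + c̄c·(Δ_μφ)·z` (exact) and its norm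
   forms **`norm_phi_mul_Pdir_le`** / **`norm_LapS_phi_mul_le`** under `|δφ| ≤ g`, `|Δ_μφ| ≤ h`;
 * §2 summed over `x ∈ Ω` and `μ`: **`sum_normSq_LapS_phi_mul_le`** and **THE END `weighted_hdiag_le`** (`z` supported in `Ω`, `φ` kills
   the corner layer; `E_c(z) = Σ_μ‖∂_μz‖²` the torus energy of the zero extension, boundary bonds included):
   `Σ_μ Σ_{x∈Ω} φ(x)²|(P_μz)(x)|² ≤ 8Σ_{x∈Ω}φ(x)²|(Δz)(x)|² + (48d + 8)‖c‖²g²·E_c(z) + (24d² + 4d)(‖c‖²)²h²·‖z‖²_Ω`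
   — NO shape hypothesis on `Ω`: the re-entrant corner term of file 1 is traded for the cutoff cost;
 * §3 in road P2's currency (`c = n`, `Ω = blockReg n S`, `z = solExt f`, gan24's three energy bounds): **`weighted_hdiag_solExt_le`**
   `Σ_μ Σ_{x∈Ω} φ(x)²|(P_μ solExt f)(x)|² ≤ (16(1 + (a′γ′⁻¹)²) + (48d + 8)γ′⁻¹(n·g)² + (24d² + 4d)γ′⁻²(n²·h)²)·‖f‖²` on ANY union of unit
   blocks — LEVEL-UNIFORM for every cutoff varying on the block scale (`n·g`, `n²·h` bounded; the construction of such a cutoff for box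
   holes is lattice geometry, not in this file): the interior diagonal Hessian of a region Dirichlet solution is bounded UP TO THE FACES
   wherever the cutoff is `1`, so the growth of the scalar budget on a re-entrant region (file 1's corner mass) lives near the edges.

HONEST FRAMING (T4-DAG p. 1).  [folklore] finite lattice calculus on the cell's typed `U = 1` objects (one region, finite torus); the
cutoff is DATA with displayed difference bounds (no geometric construction here); nothing about [B9]'s printed regions; `hinjK` ∕ W3 off
boxes OPEN; Δ1 NOT closed; NE2 (U1a) NOT proved; spine PROVED 0/9 unchanged; NOT [B9] (3.16)/(3.23)–(3.27)/(3.42) as printed; NOT infinite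
volume, NOT a mass gap, NOT the Clay problem.  HONEST DEPENDENCY: continuum YM on T⁴ ⇐ BetaPertH ∧ nine spine estimates (0/9 proved);
BetaPertH ⇐ (D1) ∧ (D4) ∧ CAP+tail; G-an2-4 gates asym, D1 and NE2/3/4.  No `sorry`.
-/

noncomputable section
open scoped BigOperators ComplexConjugate Matrix
open Finset
namespace Summit.QuantumFields.BalabanUV.T4Continuum.DirichletCornerCutoffH2

open Literature.MathematicalPhysics.QuantumFieldTheory.Balaban1983to89.B5Prop11Plancherel (Tor fine unitVec)
open Literature.MathematicalPhysics.QuantumFieldTheory.Balaban1983to89.B5Action121 (sdiff LapS sdiff_mulVec)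
open Literature.MathematicalPhysics.QuantumFieldTheory.Balaban1983to89.B5Prop11Lower (nsq nsq_nonneg)
open Summit.QuantumFields.BalabanUV.T4Continuum
open Summit.QuantumFields.BalabanUV.T4Continuum.ScalarAveragedPropagator (gammaPs gammaPs_pos)
open Summit.QuantumFields.BalabanUV.Beta.GAN24.DirichletBoxRegularity (Pdir Pdir_mulVec LapS_mulVec_eq_sum SuppIn Hdiag Hmixed hmixed_nonneg)
open Summit.QuantumFields.BalabanUV.Beta.GAN24.DirichletBoxCompression (solExt solExt_apply_of_not dirichlet_solExt_le nsq_solExt_le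
  sum_normSq_LapS_solExt_le)
open Summit.QuantumFields.BalabanUV.Beta.GAN24.DirichletBoxTrace (blockReg)
open Summit.QuantumFields.BalabanUV.T4Continuum.DirichletCornerRegularity (cornerSites hdiag_le_of_cornerVanish)

variable {d : ℕ} {N : Fin d → ℕ} [hN : ∀ μ, NeZero (N μ)]

/-! ## §1 The pointwise Leibniz rule for `P_μ` and a real cutoff -/

/-- **THE POINTWISE LEIBNIZ RULE** (exact, every site): `φ(x)·(P_μ z)(x) = (P_μ(φz))(x)
+ c̄c·[(φ(x+e_μ) − φ(x))·(z(x+e_μ) − z(x)) + (φ(x−e_μ) − φ(x))·(z(x−e_μ) − z(x))] + c̄c·(φ(x+e_μ) + φ(x−e_μ) − 2φ(x))·z(x)`. [folklore] -/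
theorem phi_mul_Pdir_eq (c : ℂ) (μ : Fin d) (φ : Tor N → ℝ) (z : Tor N → ℂ) (x : Tor N) :
    (φ x : ℂ) * (Pdir N c μ *ᵥ z) x
      = (Pdir N c μ *ᵥ fun y => (φ y : ℂ) * z y) x
        + conj c * c * (((φ (x + unitVec N μ) - φ x : ℝ) : ℂ) * (z (x + unitVec N μ) - z x)
            + ((φ (x - unitVec N μ) - φ x : ℝ) : ℂ) * (z (x - unitVec N μ) - z x))
        + conj c * c * ((φ (x + unitVec N μ) + φ (x - unitVec N μ) - 2 * φ x : ℝ) : ℂ) * z x := by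
  rw [Pdir_mulVec, Pdir_mulVec]
  push_cast
  ring

/-- the backward difference in the `∂_μ` currency: `c·(z(x−e_μ) − z(x)) = −(∂_μ z)(x − e_μ)`. [folklore] -/
theorem mul_sub_eq_neg_sdiff (c : ℂ) (μ : Fin d) (z : Tor N → ℂ) (x : Tor N) :
    c * (z (x - unitVec N μ) - z x) = -((sdiff N c μ *ᵥ z) (x - unitVec N μ)) := by
  rw [sdiff_mulVec, sub_add_cancel]
  ring

/-- the forward difference in the `∂_μ` currency: `c·(z(x+e_μ) − z(x)) = (∂_μ z)(x)`. [folklore] -/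
theorem mul_sub_eq_sdiff (c : ℂ) (μ : Fin d) (z : Tor N → ℂ) (x : Tor N) :
    c * (z (x + unitVec N μ) - z x) = (sdiff N c μ *ᵥ z) x := by
  rw [sdiff_mulVec]

/-- **THE POINTWISE COMMUTATOR BOUND**: if `|φ(y+e_ν) − φ(y)| ≤ g` and `|φ(y+e_ν) + φ(y−e_ν) − 2φ(y)| ≤ h` everywhere then
`|φ(x)(P_μz)(x) − (P_μ(φz))(x)| ≤ ‖c‖g·(|(∂_μz)(x)| + |(∂_μz)(x−e_μ)|) + ‖c‖²h·|z(x)|`. [folklore] -/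
theorem norm_comm_Pdir_le (c : ℂ) (μ : Fin d) {φ : Tor N → ℝ} {g h : ℝ}
    (hg : ∀ y ν, |φ (y + unitVec N ν) - φ y| ≤ g) (hh : ∀ y ν, |φ (y + unitVec N ν) + φ (y - unitVec N ν) - 2 * φ y| ≤ h)
    (z : Tor N → ℂ) (x : Tor N) :
    ‖(φ x : ℂ) * (Pdir N c μ *ᵥ z) x - (Pdir N c μ *ᵥ fun y => (φ y : ℂ) * z y) x‖
      ≤ ‖c‖ * g * (‖(sdiff N c μ *ᵥ z) x‖ + ‖(sdiff N c μ *ᵥ z) (x - unitVec N μ)‖) + ‖c‖ ^ 2 * h * ‖z x‖ := by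
  have hgm : |φ (x - unitVec N μ) - φ x| ≤ g := by
    have := hg (x - unitVec N μ) μ
    rwa [sub_add_cancel, abs_sub_comm] at this
  have hcomm : (φ x : ℂ) * (Pdir N c μ *ᵥ z) x - (Pdir N c μ *ᵥ fun y => (φ y : ℂ) * z y) x
      = conj c * c * (((φ (x + unitVec N μ) - φ x : ℝ) : ℂ) * (z (x + unitVec N μ) - z x)
            + ((φ (x - unitVec N μ) - φ x : ℝ) : ℂ) * (z (x - unitVec N μ) - z x))
        + conj c * c * ((φ (x + unitVec N μ) + φ (x - unitVec N μ) - 2 * φ x : ℝ) : ℂ) * z x := by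
    rw [phi_mul_Pdir_eq c μ φ z x]; ring
  rw [hcomm]
  refine (norm_add_le _ _).trans (add_le_add ?_ ?_)
  · rw [norm_mul, norm_mul, Complex.norm_conj]
    have e1 : ‖c‖ * ‖z (x + unitVec N μ) - z x‖ = ‖(sdiff N c μ *ᵥ z) x‖ := by rw [← norm_mul, mul_sub_eq_sdiff]
    have e2 : ‖c‖ * ‖z (x - unitVec N μ) - z x‖ = ‖(sdiff N c μ *ᵥ z) (x - unitVec N μ)‖ := by
      rw [← norm_mul, mul_sub_eq_neg_sdiff, norm_neg]
    have hcc : 0 ≤ ‖c‖ * ‖c‖ := by positivity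
    have hgp := hg x μ
    calc ‖c‖ * ‖c‖ * ‖((φ (x + unitVec N μ) - φ x : ℝ) : ℂ) * (z (x + unitVec N μ) - z x)
            + ((φ (x - unitVec N μ) - φ x : ℝ) : ℂ) * (z (x - unitVec N μ) - z x)‖
        ≤ ‖c‖ * ‖c‖ * (‖((φ (x + unitVec N μ) - φ x : ℝ) : ℂ) * (z (x + unitVec N μ) - z x)‖
            + ‖((φ (x - unitVec N μ) - φ x : ℝ) : ℂ) * (z (x - unitVec N μ) - z x)‖) :=
          mul_le_mul_of_nonneg_left (norm_add_le _ _) hcc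
      _ = ‖c‖ * ‖c‖ * (|φ (x + unitVec N μ) - φ x| * ‖z (x + unitVec N μ) - z x‖
            + |φ (x - unitVec N μ) - φ x| * ‖z (x - unitVec N μ) - z x‖) := by
          rw [norm_mul, norm_mul, Complex.norm_real, Complex.norm_real, Real.norm_eq_abs, Real.norm_eq_abs]
      _ ≤ ‖c‖ * ‖c‖ * (g * ‖z (x + unitVec N μ) - z x‖ + g * ‖z (x - unitVec N μ) - z x‖) := by
          gcongr
      _ = ‖c‖ * g * (‖c‖ * ‖z (x + unitVec N μ) - z x‖ + ‖c‖ * ‖z (x - unitVec N μ) - z x‖) := by ring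
      _ = ‖c‖ * g * (‖(sdiff N c μ *ᵥ z) x‖ + ‖(sdiff N c μ *ᵥ z) (x - unitVec N μ)‖) := by rw [e1, e2]
  · rw [norm_mul, norm_mul, norm_mul, Complex.norm_conj, Complex.norm_real, Real.norm_eq_abs]
    have hhp := hh x μ
    calc ‖c‖ * ‖c‖ * |φ (x + unitVec N μ) + φ (x - unitVec N μ) - 2 * φ x| * ‖z x‖
        ≤ ‖c‖ * ‖c‖ * h * ‖z x‖ := by gcongr
      _ = ‖c‖ ^ 2 * h * ‖z x‖ := by ring

/-- hence `|φ(x)(P_μz)(x)| ≤ |(P_μ(φz))(x)| + ‖c‖g·(|(∂_μz)(x)| + |(∂_μz)(x−e_μ)|) + ‖c‖²h·|z(x)|`. [folklore] -/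
theorem norm_phi_mul_Pdir_le (c : ℂ) (μ : Fin d) {φ : Tor N → ℝ} {g h : ℝ}
    (hg : ∀ y ν, |φ (y + unitVec N ν) - φ y| ≤ g) (hh : ∀ y ν, |φ (y + unitVec N ν) + φ (y - unitVec N ν) - 2 * φ y| ≤ h)
    (z : Tor N → ℂ) (x : Tor N) :
    ‖(φ x : ℂ) * (Pdir N c μ *ᵥ z) x‖
      ≤ ‖(Pdir N c μ *ᵥ fun y => (φ y : ℂ) * z y) x‖
        + (‖c‖ * g * (‖(sdiff N c μ *ᵥ z) x‖ + ‖(sdiff N c μ *ᵥ z) (x - unitVec N μ)‖) + ‖c‖ ^ 2 * h * ‖z x‖) := by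
  have h1 := norm_comm_Pdir_le c μ hg hh z x
  have h2 : ‖(φ x : ℂ) * (Pdir N c μ *ᵥ z) x‖
      ≤ ‖(Pdir N c μ *ᵥ fun y => (φ y : ℂ) * z y) x‖
        + ‖(φ x : ℂ) * (Pdir N c μ *ᵥ z) x - (Pdir N c μ *ᵥ fun y => (φ y : ℂ) * z y) x‖ := by
    have := norm_add_le ((Pdir N c μ *ᵥ fun y => (φ y : ℂ) * z y) x)
      ((φ x : ℂ) * (Pdir N c μ *ᵥ z) x - (Pdir N c μ *ᵥ fun y => (φ y : ℂ) * z y) x)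
    rwa [add_sub_cancel] at this
  exact h2.trans (add_le_add le_rfl h1)

/-- the squared form: `φ(x)²|(P_μz)(x)|² ≤ 4·(|(P_μ(φz))(x)|² + ‖c‖²g²|(∂_μz)(x)|² + ‖c‖²g²|(∂_μz)(x−e_μ)|² + ‖c‖⁴h²|z(x)|²)`. [folklore] -/
theorem sq_phi_mul_normSq_Pdir_le (c : ℂ) (μ : Fin d) {φ : Tor N → ℝ} {g h : ℝ}
    (hg : ∀ y ν, |φ (y + unitVec N ν) - φ y| ≤ g) (hh : ∀ y ν, |φ (y + unitVec N ν) + φ (y - unitVec N ν) - 2 * φ y| ≤ h)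
    (z : Tor N → ℂ) (x : Tor N) :
    φ x ^ 2 * ‖(Pdir N c μ *ᵥ z) x‖ ^ 2
      ≤ 4 * (‖(Pdir N c μ *ᵥ fun y => (φ y : ℂ) * z y) x‖ ^ 2 + ‖c‖ ^ 2 * g ^ 2 * ‖(sdiff N c μ *ᵥ z) x‖ ^ 2
          + ‖c‖ ^ 2 * g ^ 2 * ‖(sdiff N c μ *ᵥ z) (x - unitVec N μ)‖ ^ 2 + (‖c‖ ^ 2) ^ 2 * h ^ 2 * ‖z x‖ ^ 2) := by
  have h1 := norm_phi_mul_Pdir_le c μ hg hh z x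
  have hsq : φ x ^ 2 * ‖(Pdir N c μ *ᵥ z) x‖ ^ 2 = ‖(φ x : ℂ) * (Pdir N c μ *ᵥ z) x‖ ^ 2 := by
    rw [norm_mul, Complex.norm_real, Real.norm_eq_abs, mul_pow, sq_abs]
  rw [hsq]
  have h0 : 0 ≤ ‖(φ x : ℂ) * (Pdir N c μ *ᵥ z) x‖ := norm_nonneg _
  calc ‖(φ x : ℂ) * (Pdir N c μ *ᵥ z) x‖ ^ 2
      ≤ (‖(Pdir N c μ *ᵥ fun y => (φ y : ℂ) * z y) x‖ + ‖c‖ * g * ‖(sdiff N c μ *ᵥ z) x‖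
          + ‖c‖ * g * ‖(sdiff N c μ *ᵥ z) (x - unitVec N μ)‖ + ‖c‖ ^ 2 * h * ‖z x‖) ^ 2 :=
        pow_le_pow_left₀ h0 (h1.trans (le_of_eq (by ring))) 2
    _ ≤ _ := by
        set p := ‖(Pdir N c μ *ᵥ fun y => (φ y : ℂ) * z y) x‖
        set q := ‖c‖ * g * ‖(sdiff N c μ *ᵥ z) x‖
        set r := ‖c‖ * g * ‖(sdiff N c μ *ᵥ z) (x - unitVec N μ)‖
        set t := ‖c‖ ^ 2 * h * ‖z x‖
        have h4 : (p + q + r + t) ^ 2 ≤ 4 * (p ^ 2 + q ^ 2 + r ^ 2 + t ^ 2) := by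
          nlinarith [sq_nonneg (p - q), sq_nonneg (p - r), sq_nonneg (p - t), sq_nonneg (q - r), sq_nonneg (q - t), sq_nonneg (r - t)]
        refine h4.trans (le_of_eq ?_)
        simp only [q, r, t]
        ring

/-- **THE POINTWISE LEIBNIZ RULE FOR `Δ`** in norm form:
`|(Δ(φz))(x)| ≤ |φ(x)|·|(Δz)(x)| + Σ_μ (‖c‖g·(|(∂_μz)(x)| + |(∂_μz)(x−e_μ)|) + ‖c‖²h·|z(x)|)`. [folklore] -/
theorem norm_LapS_phi_mul_le (c : ℂ) {φ : Tor N → ℝ} {g h : ℝ}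
    (hg : ∀ y ν, |φ (y + unitVec N ν) - φ y| ≤ g) (hh : ∀ y ν, |φ (y + unitVec N ν) + φ (y - unitVec N ν) - 2 * φ y| ≤ h)
    (z : Tor N → ℂ) (x : Tor N) :
    ‖(LapS N c *ᵥ fun y => (φ y : ℂ) * z y) x‖
      ≤ |φ x| * ‖(LapS N c *ᵥ z) x‖
        + ∑ μ, (‖c‖ * g * (‖(sdiff N c μ *ᵥ z) x‖ + ‖(sdiff N c μ *ᵥ z) (x - unitVec N μ)‖) + ‖c‖ ^ 2 * h * ‖z x‖) := by
  set w : Tor N → ℂ := fun y => (φ y : ℂ) * z y with hw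
  -- `Δw = φ·Δz − Σ_μ (φ·P_μ z − P_μ w)`
  have hsplit : (LapS N c *ᵥ w) x
      = (φ x : ℂ) * (LapS N c *ᵥ z) x - ∑ μ, ((φ x : ℂ) * (Pdir N c μ *ᵥ z) x - (Pdir N c μ *ᵥ w) x) := by
    rw [LapS_mulVec_eq_sum, LapS_mulVec_eq_sum, mul_sum, ← sum_sub_distrib]
    exact sum_congr rfl fun μ _ => by ring
  rw [hsplit]
  refine (norm_sub_le _ _).trans (add_le_add ?_ ?_)
  · rw [norm_mul, Complex.norm_real, Real.norm_eq_abs]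
  · exact (norm_sum_le _ _).trans (sum_le_sum fun μ _ => norm_comm_Pdir_le c μ hg hh z x)

/-! ## §2 Summed over the region: the cutoff `H²` inequality -/

section Sums

variable (c : ℂ) (Ω : Finset (Tor N)) {φ : Tor N → ℝ} {g h : ℝ} (z : Tor N → ℂ)

omit hN in
/-- the shifted energy is the energy: `Σ_x |(∂_μz)(x − e_μ)|² = ‖∂_μz‖²`. [folklore] -/
theorem sum_normSq_sdiff_shift [∀ μ, NeZero (N μ)] (μ : Fin d) :
    ∑ x, ‖(sdiff N c μ *ᵥ z) (x - unitVec N μ)‖ ^ 2 = nsq (sdiff N c μ *ᵥ z) :=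
  Fintype.sum_equiv (Equiv.subRight (unitVec N μ)) _ _ fun _ => rfl

/-- a sum of nonnegative terms over `Ω` is at most the sum over the torus. [folklore] -/
theorem sum_le_univ_of_nonneg {F : Tor N → ℝ} (hF : ∀ x, 0 ≤ F x) : ∑ x ∈ Ω, F x ≤ ∑ x, F x :=
  sum_le_sum_of_subset_of_nonneg (subset_univ Ω) fun x _ _ => hF x

/-- **THE `Δ` SIDE**:
`Σ_{x∈Ω}|(Δ(φz))(x)|² ≤ 2Σ_{x∈Ω}φ(x)²|(Δz)(x)|² + 12d‖c‖²g²·Σ_μ‖∂_μz‖² + 6d²(‖c‖²)²h²·Σ_{x∈Ω}|z(x)|²`. [folklore] -/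
theorem sum_normSq_LapS_phi_mul_le
    (hg : ∀ y ν, |φ (y + unitVec N ν) - φ y| ≤ g) (hh : ∀ y ν, |φ (y + unitVec N ν) + φ (y - unitVec N ν) - 2 * φ y| ≤ h) :
    ∑ x ∈ Ω, ‖(LapS N c *ᵥ fun y => (φ y : ℂ) * z y) x‖ ^ 2
      ≤ 2 * ∑ x ∈ Ω, φ x ^ 2 * ‖(LapS N c *ᵥ z) x‖ ^ 2
        + 12 * d * (‖c‖ ^ 2 * g ^ 2) * ∑ μ, nsq (sdiff N c μ *ᵥ z)
        + 6 * (d : ℝ) ^ 2 * ((‖c‖ ^ 2) ^ 2 * h ^ 2) * ∑ x ∈ Ω, ‖z x‖ ^ 2 := by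
  have hpt : ∀ x, ‖(LapS N c *ᵥ fun y => (φ y : ℂ) * z y) x‖ ^ 2
      ≤ 2 * (φ x ^ 2 * ‖(LapS N c *ᵥ z) x‖ ^ 2)
        + 2 * d * ∑ μ, 3 * (‖c‖ ^ 2 * g ^ 2 * ‖(sdiff N c μ *ᵥ z) x‖ ^ 2
            + ‖c‖ ^ 2 * g ^ 2 * ‖(sdiff N c μ *ᵥ z) (x - unitVec N μ)‖ ^ 2 + (‖c‖ ^ 2) ^ 2 * h ^ 2 * ‖z x‖ ^ 2) := by
    intro x
    set A := |φ x| * ‖(LapS N c *ᵥ z) x‖ with hA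
    set T : Fin d → ℝ := fun μ =>
      ‖c‖ * g * (‖(sdiff N c μ *ᵥ z) x‖ + ‖(sdiff N c μ *ᵥ z) (x - unitVec N μ)‖) + ‖c‖ ^ 2 * h * ‖z x‖ with hT
    have h1 : ‖(LapS N c *ᵥ fun y => (φ y : ℂ) * z y) x‖ ≤ A + ∑ μ, T μ := norm_LapS_phi_mul_le c hg hh z x
    have hA0 : 0 ≤ A := mul_nonneg (abs_nonneg _) (norm_nonneg _)
    have hg0 : ∀ μ : Fin d, 0 ≤ g := fun μ => le_trans (abs_nonneg _) (hg x μ)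
    have hh0 : ∀ μ : Fin d, 0 ≤ h := fun μ => le_trans (abs_nonneg _) (hh x μ)
    have hT0 : ∀ μ, 0 ≤ T μ := fun μ => by
      have := hg0 μ; have := hh0 μ; positivity
    have hS0 : 0 ≤ ∑ μ, T μ := sum_nonneg fun μ _ => hT0 μ
    have h2 : ‖(LapS N c *ᵥ fun y => (φ y : ℂ) * z y) x‖ ^ 2 ≤ 2 * A ^ 2 + 2 * (∑ μ, T μ) ^ 2 := by
      have := pow_le_pow_left₀ (norm_nonneg _) h1 2
      nlinarith [sq_nonneg (A - ∑ μ, T μ)]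
    have h3 : (∑ μ, T μ) ^ 2 ≤ d * ∑ μ, T μ ^ 2 := by
      have := sq_sum_le_card_mul_sum_sq (s := (univ : Finset (Fin d))) (f := T)
      rwa [card_univ, Fintype.card_fin] at this
    have h4 : ∀ μ, T μ ^ 2 ≤ 3 * (‖c‖ ^ 2 * g ^ 2 * ‖(sdiff N c μ *ᵥ z) x‖ ^ 2
        + ‖c‖ ^ 2 * g ^ 2 * ‖(sdiff N c μ *ᵥ z) (x - unitVec N μ)‖ ^ 2 + (‖c‖ ^ 2) ^ 2 * h ^ 2 * ‖z x‖ ^ 2) := fun μ => by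
      have e : T μ = ‖c‖ * g * ‖(sdiff N c μ *ᵥ z) x‖ + ‖c‖ * g * ‖(sdiff N c μ *ᵥ z) (x - unitVec N μ)‖
          + ‖c‖ ^ 2 * h * ‖z x‖ := by rw [hT]; ring
      rw [e]
      set p := ‖c‖ * g * ‖(sdiff N c μ *ᵥ z) x‖
      set q := ‖c‖ * g * ‖(sdiff N c μ *ᵥ z) (x - unitVec N μ)‖
      set r := ‖c‖ ^ 2 * h * ‖z x‖
      have h3' : (p + q + r) ^ 2 ≤ 3 * (p ^ 2 + q ^ 2 + r ^ 2) := by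
        nlinarith [sq_nonneg (p - q), sq_nonneg (p - r), sq_nonneg (q - r)]
      refine h3'.trans (le_of_eq ?_)
      simp only [p, q, r]
      ring
    have hA2 : A ^ 2 ≤ φ x ^ 2 * ‖(LapS N c *ᵥ z) x‖ ^ 2 := by rw [hA, mul_pow, sq_abs]
    have h5 : (∑ μ, T μ) ^ 2 ≤ d * ∑ μ, 3 * (‖c‖ ^ 2 * g ^ 2 * ‖(sdiff N c μ *ᵥ z) x‖ ^ 2
        + ‖c‖ ^ 2 * g ^ 2 * ‖(sdiff N c μ *ᵥ z) (x - unitVec N μ)‖ ^ 2 + (‖c‖ ^ 2) ^ 2 * h ^ 2 * ‖z x‖ ^ 2) :=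
      h3.trans (mul_le_mul_of_nonneg_left (sum_le_sum fun μ _ => h4 μ) (Nat.cast_nonneg d))
    nlinarith
  -- sum over `x ∈ Ω`
  have hsum := sum_le_sum fun x (_ : x ∈ Ω) => hpt x
  refine hsum.trans ?_
  rw [sum_add_distrib, ← mul_sum, ← mul_sum]
  -- bound the remainder sums by torus sums / shifted energies
  have hrem : ∑ x ∈ Ω, ∑ μ, 3 * (‖c‖ ^ 2 * g ^ 2 * ‖(sdiff N c μ *ᵥ z) x‖ ^ 2
        + ‖c‖ ^ 2 * g ^ 2 * ‖(sdiff N c μ *ᵥ z) (x - unitVec N μ)‖ ^ 2 + (‖c‖ ^ 2) ^ 2 * h ^ 2 * ‖z x‖ ^ 2)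
      ≤ 6 * (‖c‖ ^ 2 * g ^ 2) * ∑ μ, nsq (sdiff N c μ *ᵥ z) + 3 * d * ((‖c‖ ^ 2) ^ 2 * h ^ 2) * ∑ x ∈ Ω, ‖z x‖ ^ 2 := by
    have e1 : ∑ x ∈ Ω, ∑ μ, 3 * (‖c‖ ^ 2 * g ^ 2 * ‖(sdiff N c μ *ᵥ z) x‖ ^ 2
          + ‖c‖ ^ 2 * g ^ 2 * ‖(sdiff N c μ *ᵥ z) (x - unitVec N μ)‖ ^ 2 + (‖c‖ ^ 2) ^ 2 * h ^ 2 * ‖z x‖ ^ 2)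
        = 3 * (‖c‖ ^ 2 * g ^ 2) * ∑ μ, (∑ x ∈ Ω, ‖(sdiff N c μ *ᵥ z) x‖ ^ 2 + ∑ x ∈ Ω, ‖(sdiff N c μ *ᵥ z) (x - unitVec N μ)‖ ^ 2)
          + 3 * d * ((‖c‖ ^ 2) ^ 2 * h ^ 2) * ∑ x ∈ Ω, ‖z x‖ ^ 2 := by
      rw [sum_comm]
      simp only [mul_add, sum_add_distrib, ← mul_sum, sum_const, card_univ, Fintype.card_fin, nsmul_eq_mul]
      ring
    rw [e1]
    have e2 : ∀ μ, ∑ x ∈ Ω, ‖(sdiff N c μ *ᵥ z) x‖ ^ 2 + ∑ x ∈ Ω, ‖(sdiff N c μ *ᵥ z) (x - unitVec N μ)‖ ^ 2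
        ≤ 2 * nsq (sdiff N c μ *ᵥ z) := fun μ => by
      have a1 : ∑ x ∈ Ω, ‖(sdiff N c μ *ᵥ z) x‖ ^ 2 ≤ nsq (sdiff N c μ *ᵥ z) :=
        sum_le_univ_of_nonneg Ω fun x => by positivity
      have a2 : ∑ x ∈ Ω, ‖(sdiff N c μ *ᵥ z) (x - unitVec N μ)‖ ^ 2 ≤ nsq (sdiff N c μ *ᵥ z) :=
        (sum_le_univ_of_nonneg Ω fun x => by positivity).trans (le_of_eq (sum_normSq_sdiff_shift c z μ))
      linarith
    have hcg : 0 ≤ 3 * (‖c‖ ^ 2 * g ^ 2) := by positivity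
    have := mul_le_mul_of_nonneg_left (sum_le_sum fun μ (_ : μ ∈ univ) => e2 μ) hcg
    rw [← mul_sum] at this
    linarith
  have hd : (0 : ℝ) ≤ 2 * d := by positivity
  have := mul_le_mul_of_nonneg_left hrem hd
  linarith

/-- **THE END — THE CUTOFF `H²` INEQUALITY ON AN ARBITRARY REGION**: `z` supported in `Ω`, `φ` a real cutoff with
`|δφ| ≤ g`, `|Δ_μφ| ≤ h`, vanishing on the `Ω`-neighbours of every corner site of `Ω`.  Then
`Σ_μ Σ_{x∈Ω} φ(x)²|(P_μz)(x)|² ≤ 8Σ_{x∈Ω}φ(x)²|(Δz)(x)|² + (48d + 8)‖c‖²g²·Σ_μ‖∂_μz‖² + (24d² + 4d)(‖c‖²)²h²·Σ_{x∈Ω}|z(x)|²`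
— no shape hypothesis on `Ω`, no size hypothesis on `φ`. [folklore] -/
theorem weighted_hdiag_le (hz : SuppIn N Ω z)
    (hg : ∀ y ν, |φ (y + unitVec N ν) - φ y| ≤ g) (hh : ∀ y ν, |φ (y + unitVec N ν) + φ (y - unitVec N ν) - 2 * φ y| ≤ h)
    (hcorner : ∀ x ∈ cornerSites Ω, ∀ μ, (x + unitVec N μ ∈ Ω → φ (x + unitVec N μ) = 0) ∧ (x - unitVec N μ ∈ Ω → φ (x - unitVec N μ) = 0)) :
    ∑ μ, ∑ x ∈ Ω, φ x ^ 2 * ‖(Pdir N c μ *ᵥ z) x‖ ^ 2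
      ≤ 8 * ∑ x ∈ Ω, φ x ^ 2 * ‖(LapS N c *ᵥ z) x‖ ^ 2
        + (48 * d + 8) * (‖c‖ ^ 2 * g ^ 2) * ∑ μ, nsq (sdiff N c μ *ᵥ z)
        + (24 * (d : ℝ) ^ 2 + 4 * d) * ((‖c‖ ^ 2) ^ 2 * h ^ 2) * ∑ x ∈ Ω, ‖z x‖ ^ 2 := by
  set w : Tor N → ℂ := fun y => (φ y : ℂ) * z y with hw
  -- `w` is supported in `Ω` and vanishes on the corner layer
  have hws : SuppIn N Ω w := fun x hx => by simp only [hw, hz x hx, mul_zero]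
  have hwv : ∀ x ∈ cornerSites Ω, ∀ μ, w (x + unitVec N μ) = 0 ∧ w (x - unitVec N μ) = 0 := by
    intro x hx μ
    refine ⟨?_, ?_⟩
    · by_cases hm : x + unitVec N μ ∈ Ω
      · simp only [hw, (hcorner x hx μ).1 hm, Complex.ofReal_zero, zero_mul]
      · simp only [hw, hz _ hm, mul_zero]
    · by_cases hm : x - unitVec N μ ∈ Ω
      · simp only [hw, (hcorner x hx μ).2 hm, Complex.ofReal_zero, zero_mul]
      · simp only [hw, hz _ hm, mul_zero]
  -- step 1: pointwise squares summed: `Σ φ²|P z|² ≤ 4 Hdiag(w) + 8‖c‖²g² E + 4d ‖c‖⁴h² ‖z‖²_Ω`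
  have h1 : ∑ μ, ∑ x ∈ Ω, φ x ^ 2 * ‖(Pdir N c μ *ᵥ z) x‖ ^ 2
      ≤ 4 * Hdiag c Ω w + 8 * (‖c‖ ^ 2 * g ^ 2) * ∑ μ, nsq (sdiff N c μ *ᵥ z)
        + 4 * d * ((‖c‖ ^ 2) ^ 2 * h ^ 2) * ∑ x ∈ Ω, ‖z x‖ ^ 2 := by
    have hpt := fun μ x => sq_phi_mul_normSq_Pdir_le c μ hg hh z x
    have hsum : ∑ μ, ∑ x ∈ Ω, φ x ^ 2 * ‖(Pdir N c μ *ᵥ z) x‖ ^ 2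
        ≤ ∑ μ, ∑ x ∈ Ω, 4 * (‖(Pdir N c μ *ᵥ w) x‖ ^ 2 + ‖c‖ ^ 2 * g ^ 2 * ‖(sdiff N c μ *ᵥ z) x‖ ^ 2
            + ‖c‖ ^ 2 * g ^ 2 * ‖(sdiff N c μ *ᵥ z) (x - unitVec N μ)‖ ^ 2 + (‖c‖ ^ 2) ^ 2 * h ^ 2 * ‖z x‖ ^ 2) :=
      sum_le_sum fun μ _ => sum_le_sum fun x _ => hpt μ x
    refine hsum.trans ?_
    have e1 : ∑ μ, ∑ x ∈ Ω, 4 * (‖(Pdir N c μ *ᵥ w) x‖ ^ 2 + ‖c‖ ^ 2 * g ^ 2 * ‖(sdiff N c μ *ᵥ z) x‖ ^ 2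
            + ‖c‖ ^ 2 * g ^ 2 * ‖(sdiff N c μ *ᵥ z) (x - unitVec N μ)‖ ^ 2 + (‖c‖ ^ 2) ^ 2 * h ^ 2 * ‖z x‖ ^ 2)
        = 4 * Hdiag c Ω w
          + 4 * (‖c‖ ^ 2 * g ^ 2) * ∑ μ, (∑ x ∈ Ω, ‖(sdiff N c μ *ᵥ z) x‖ ^ 2 + ∑ x ∈ Ω, ‖(sdiff N c μ *ᵥ z) (x - unitVec N μ)‖ ^ 2)
          + 4 * d * ((‖c‖ ^ 2) ^ 2 * h ^ 2) * ∑ x ∈ Ω, ‖z x‖ ^ 2 := by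
      unfold Hdiag
      simp only [mul_add, sum_add_distrib, ← mul_sum, sum_const, card_univ, Fintype.card_fin, nsmul_eq_mul]
      ring
    rw [e1]
    have e2 : ∀ μ, ∑ x ∈ Ω, ‖(sdiff N c μ *ᵥ z) x‖ ^ 2 + ∑ x ∈ Ω, ‖(sdiff N c μ *ᵥ z) (x - unitVec N μ)‖ ^ 2
        ≤ 2 * nsq (sdiff N c μ *ᵥ z) := fun μ => by
      have a1 : ∑ x ∈ Ω, ‖(sdiff N c μ *ᵥ z) x‖ ^ 2 ≤ nsq (sdiff N c μ *ᵥ z) :=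
        sum_le_univ_of_nonneg Ω fun x => by positivity
      have a2 : ∑ x ∈ Ω, ‖(sdiff N c μ *ᵥ z) (x - unitVec N μ)‖ ^ 2 ≤ nsq (sdiff N c μ *ᵥ z) :=
        (sum_le_univ_of_nonneg Ω fun x => by positivity).trans (le_of_eq (sum_normSq_sdiff_shift c z μ))
      linarith
    have hcg : 0 ≤ 4 * (‖c‖ ^ 2 * g ^ 2) := by positivity
    have := mul_le_mul_of_nonneg_left (sum_le_sum fun μ (_ : μ ∈ univ) => e2 μ) hcg
    rw [← mul_sum] at this
    linarith
  -- step 2: `Hdiag(w) ≤ Σ_Ω |Δw|²` (file 1, corner-vanish form)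
  have h2 : Hdiag c Ω w ≤ ∑ x ∈ Ω, ‖(LapS N c *ᵥ w) x‖ ^ 2 :=
    le_trans (le_add_of_nonneg_right (hmixed_nonneg c w)) (hdiag_le_of_cornerVanish hws hwv c)
  -- step 3: the `Δ` side
  have h3 := sum_normSq_LapS_phi_mul_le c Ω z hg hh
  have h4pos : (0 : ℝ) ≤ 4 := by norm_num
  nlinarith [h1, h2, h3]

end Sums

/-! ## §3 In road P2's currency: the weighted Hessian of a region Dirichlet solution on any union of unit blocks -/

section Region

variable (n : ℕ) [NeZero n] (M : Fin d → ℕ) [hM : ∀ μ, NeZero (M μ)] (S : Tor M → Prop) [DecidablePred S] {a' : ℝ}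

/-- **THE WEIGHTED HESSIAN OF A REGION DIRICHLET SOLUTION ON ANY UNION OF UNIT BLOCKS** (`a′ > 0`, any decidable spelling `p` of
`Ω = blockReg n S`, any real cutoff `φ` with `|φ| ≤ 1`, `|δφ| ≤ g`, `|Δ_μφ| ≤ h` killing the `Ω`-neighbours of the corner sites):
`Σ_μ Σ_{x∈Ω} φ(x)²|(P_μ solExt f)(x)|² ≤ (16(1 + (a′γ′⁻¹)²) + (48d + 8)γ′⁻¹(n·g)² + (24d² + 4d)γ′⁻²(n²·h)²)·‖f‖²` —
level-uniform whenever `n·g` and `n²·h` are bounded (a cutoff varying on the block scale). [folklore] -/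
theorem weighted_hdiag_solExt_le (ha' : 0 < a') (p : Tor (fine n M) → Prop) [DecidablePred p] (hp : ∀ x, p x ↔ blockReg n M S x)
    {φ : Tor (fine n M) → ℝ} {g h : ℝ} (hφ1 : ∀ y, |φ y| ≤ 1)
    (hg : ∀ y ν, |φ (y + unitVec (fine n M) ν) - φ y| ≤ g)
    (hh : ∀ y ν, |φ (y + unitVec (fine n M) ν) + φ (y - unitVec (fine n M) ν) - 2 * φ y| ≤ h)
    (hcorner : ∀ x ∈ cornerSites (univ.filter (blockReg n M S)), ∀ μ,
      (x + unitVec (fine n M) μ ∈ univ.filter (blockReg n M S) → φ (x + unitVec (fine n M) μ) = 0) ∧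
      (x - unitVec (fine n M) μ ∈ univ.filter (blockReg n M S) → φ (x - unitVec (fine n M) μ) = 0))
    (f : {x // p x} → ℂ) :
    ∑ μ, ∑ x ∈ univ.filter (blockReg n M S), φ x ^ 2 * ‖(Pdir (fine n M) (n : ℂ) μ *ᵥ solExt n M a' p f) x‖ ^ 2
      ≤ (16 * (1 + (a' * (gammaPs d a')⁻¹) ^ 2) + (48 * d + 8) * (gammaPs d a')⁻¹ * ((n : ℝ) * g) ^ 2
          + (24 * (d : ℝ) ^ 2 + 4 * d) * ((gammaPs d a')⁻¹) ^ 2 * ((n : ℝ) ^ 2 * h) ^ 2) * nsq f := by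
  set u := solExt n M a' p f with hu
  set Ω := univ.filter (blockReg n M S) with hΩ
  have hsupp : SuppIn (fine n M) Ω u := by
    intro x hx
    rw [hΩ, Finset.mem_filter] at hx
    exact solExt_apply_of_not n M a' p f (fun h' => hx ⟨Finset.mem_univ _, (hp x).mp h'⟩)
  have hmain := weighted_hdiag_le (n : ℂ) Ω u hsupp hg hh hcorner
  -- the three energy bounds of road P2
  have hD : ∑ μ, nsq (sdiff (fine n M) (n : ℂ) μ *ᵥ u) ≤ (gammaPs d a')⁻¹ * nsq f := dirichlet_solExt_le n M a' _ ha' f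
  have hZ : ∑ x ∈ Ω, ‖u x‖ ^ 2 ≤ ((gammaPs d a')⁻¹) ^ 2 * nsq f :=
    (sum_le_univ_of_nonneg Ω fun x => by positivity).trans (nsq_solExt_le n M a' p ha' f)
  have hF : ∑ x ∈ Ω, φ x ^ 2 * ‖(LapS (fine n M) (n : ℂ) *ᵥ u) x‖ ^ 2 ≤ 2 * (1 + (a' * (gammaPs d a')⁻¹) ^ 2) * nsq f := by
    have h1 : ∑ x ∈ Ω, φ x ^ 2 * ‖(LapS (fine n M) (n : ℂ) *ᵥ u) x‖ ^ 2 ≤ ∑ x ∈ Ω, ‖(LapS (fine n M) (n : ℂ) *ᵥ u) x‖ ^ 2 := by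
      refine sum_le_sum fun x _ => ?_
      have hφ : φ x ^ 2 ≤ 1 := by
        have := hφ1 x
        rw [← sq_abs]; nlinarith [abs_nonneg (φ x)]
      have := mul_le_mul_of_nonneg_right hφ (sq_nonneg ‖(LapS (fine n M) (n : ℂ) *ᵥ u) x‖)
      rwa [one_mul] at this
    have h2 : ∑ x ∈ Ω, ‖(LapS (fine n M) (n : ℂ) *ᵥ u) x‖ ^ 2 = ∑ a : {x // p x}, ‖(LapS (fine n M) (n : ℂ) *ᵥ u) a‖ ^ 2 :=
      Finset.sum_subtype _ (fun x => by simp [hΩ, hp x]) (fun x => ‖(LapS (fine n M) (n : ℂ) *ᵥ u) x‖ ^ 2)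
    have h3 := sum_normSq_LapS_solExt_le n M a' p ha' f
    rw [← hu] at h3
    exact h1.trans (by rw [h2]; exact h3)
  have hn : ‖(n : ℂ)‖ = (n : ℝ) := Complex.norm_natCast n
  rw [hn] at hmain
  have hγ : 0 ≤ (gammaPs d a')⁻¹ := inv_nonneg.mpr (gammaPs_pos (d := d) (a' := a')).1.le
  have hA : 0 ≤ (48 * (d : ℝ) + 8) * ((n : ℝ) ^ 2 * g ^ 2) := by positivity
  have hB : 0 ≤ (24 * (d : ℝ) ^ 2 + 4 * d) * (((n : ℝ) ^ 2) ^ 2 * h ^ 2) := by positivity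
  calc ∑ μ, ∑ x ∈ Ω, φ x ^ 2 * ‖(Pdir (fine n M) (n : ℂ) μ *ᵥ u) x‖ ^ 2
      ≤ 8 * ∑ x ∈ Ω, φ x ^ 2 * ‖(LapS (fine n M) (n : ℂ) *ᵥ u) x‖ ^ 2
        + (48 * d + 8) * ((n : ℝ) ^ 2 * g ^ 2) * ∑ μ, nsq (sdiff (fine n M) (n : ℂ) μ *ᵥ u)
        + (24 * (d : ℝ) ^ 2 + 4 * d) * (((n : ℝ) ^ 2) ^ 2 * h ^ 2) * ∑ x ∈ Ω, ‖u x‖ ^ 2 := hmain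
    _ ≤ 8 * (2 * (1 + (a' * (gammaPs d a')⁻¹) ^ 2) * nsq f)
        + (48 * d + 8) * ((n : ℝ) ^ 2 * g ^ 2) * ((gammaPs d a')⁻¹ * nsq f)
        + (24 * (d : ℝ) ^ 2 + 4 * d) * (((n : ℝ) ^ 2) ^ 2 * h ^ 2) * (((gammaPs d a')⁻¹) ^ 2 * nsq f) := by
        gcongr
    _ = _ := by ring

end Region

end Summit.QuantumFields.BalabanUV.T4Continuum.DirichletCornerCutoffH2

end
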